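import Mathlib
import HarnessLib
import Summits.Ventures.LatticeQCDFlow.Exactness.SphereLuscherRecursionVariance
import Summits.Ventures.LatticeQCDFlow.Exactness.SphereLatticeLuscherKernel

/-!
# The constants of Lüscher's recursion for the lattice CP(N−1)/O(N) action: `ċ_{k+1} = 2(d−1)·∫S̃⁽ᵏ⁾(S−S₀)dπ̄`, `ċ₁ = Var_π̄(S)`, and every `ċ_{k+1}` is extensive

HONEST FRAMING: exact (Metropolis-corrected) sampling algorithms for lattice gauge theory;
figures of merit are autocorrelation/cost numbers at stated couplings and volumes; no
continuum-physics claim.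

Venture `LatticeQCDFlow` (cell pub-lqcd), topic `Exactness`; FANOUT row 7 (`s0-cpn-null`).  NEW WORK
of the cell over the tree's `Exactness/SphereLuscherRecursionVariance.lean` (this leg: `π̄`-transfer,
`∫Σ∂̃²F dπ̄ = 0`), `Exactness/SphereLatticeLuscherKernel.lean` (GEN-8: `integral_esAction`,
`loFlowAction_unique`, `contDiff_esAction`), `Exactness/SphereLOFlowAction.lean` (E–S:
`−Σ∂̃²S = 2(d−1)(S − S₀)` on `Ω`) and `Exactness/SphereLatticeGreen.lean` (polarised Green identity);
nothing is cited as a fact.  Printed counterpart, NAMED ONLY: M. Lüscher, Commun. Math. Phys. 293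
(2010) 899, §3.2–§3.3 eqs. (3.4)–(3.12): the constants `Ċ_t = Σ_k t^k ċ_k` of the recursion are
fixed order by order by the solvability condition (the source must be orthogonal to the constants);
in Lüscher's derivation `C_t` is the log-normalisation of the flowed measure, so the `ċ_k` are, up to
combinatorial factors, the Taylor coefficients of `log ∫e^{−tS}dπ̄` — cumulant-like.  Proved here
INSIDE the recursion (no `t > 0`): the solvability condition in closed form for the E–S action
(`ċ_{k+1}` is `2(d−1)` times the `π̄`-covariance of the previous order with the action) and the
order-one value `ċ₁ = Var_π̄(S)` EXACTLY — the second cumulant, as the `log Z` reading predicts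
(`ċ₀ = −S₀ = −∫S dπ̄` is GEN-8's `loFlowAction_unique`).

## Setting

`d = dim E ≥ 2`, `Λ` finite nonempty, `π̄ = ⊗_Λ σ̄` the uniform product probability measure on
`Ω = S(E)^Λ`; E–S couplings `U` (no self-coupling, adjoint pairs);
`S = esAction κ S₀ U = −κΣ_n⟪x_n, J_n⟫ + S₀`; a `C²` LÜSCHER SERIES of
`S` is a family `(St k, c k)` with `−Σ∂̃² St₀ = S + c₀` and
`−Σ∂̃² St_{k+1} = −Σ_n⟪∂̃_n S, ∂̃_n St_k⟫ + c_{k+1}` on `Ω`.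

## Content

* §1 `integral_mul_neg_luscher_uniform` (polarised Green: `∫ G·(−Σ∂̃²F)dπ̄ = Σ_n∫⟪∂̃_nG, ∂̃_nF⟫dπ̄`),
  `integral_one_uniform_mul`, **`integral_esAction_uniform`** (`∫ S dπ̄ = S₀`),
  `sq_integral_mul_le` (Cauchy–Schwarz `(∫fg)² ≤ ∫f²·∫g²` for continuous integrands on `Ω`).
* §2 **`luscher_constant_succ_eq`** — THE SOLVABILITY CONDITION IN CLOSED FORM: for every `C²`
  Lüscher series of the E–S action and every `k`,
  `c_{k+1} = 2(d−1)·∫ St_k·(S − S₀) dπ̄` (`= 2(d−1)·Cov_π̄(St_k, S)` since `∫S dπ̄ = S₀`);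
  **`luscher_constant_one_eq`** — `c₁ = ∫(S − S₀)² dπ̄ = Var_π̄(S)` EXACTLY (order `0`: GEN-8).

The sequel `Exactness/SphereLuscherConstantsExtensive.lean` bounds them: `Var_π̄(S) ≤ |Λ|(Δ+1)²(κυ)²`
and `ċ_{k+1}² ≤ 4(d−1)²·Var_π̄(S̃⁽ᵏ⁾)·Var_π̄(S)`, so every constant of the recursion is `O(|Λ|)`.

NOT CLAIMED: the identification of `ċ_k` with the cumulants of `S` / Taylor coefficients of
`log ∫e^{−tS}dπ̄` beyond `k ≤ 1` (that needs the flow at `t > 0`, not in the tree); lower bounds;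
closed forms of `ċ_k` for `k ≥ 2`; anything about autocorrelations or the rung's numbers.
-/

noncomputable section

namespace Summit.Ventures.LatticeQCDFlow.Exactness

open Function Set Metric MeasureTheory NormedSpace InnerProductSpace
open scoped RealInnerProductSpace

variable {Λ : Type*} {E : Type*} [NormedAddCommGroup E] [InnerProductSpace ℝ E]
  [FiniteDimensional ℝ E] [MeasurableSpace E] [BorelSpace E]


/-! ## §1 Polarised Green identity and the mean of the action under `π̄`; Cauchy–Schwarz -/

section Tools

variable [Fintype Λ] [DecidableEq Λ] [Nontrivial E]

/-- **Polarised Green identity under `π̄`**: `∫ G·(−Σ_n ∂̃_n·∂̃_n F) dπ̄ = Σ_n ∫⟪∂̃_n G, ∂̃_n F⟫ dπ̄`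
(`F ∈ C²`, `G ∈ C¹`). -/
theorem integral_mul_neg_luscher_uniform {F G : (Λ → E) → ℝ} (hF : ContDiff ℝ 2 F)
    (hG : ContDiff ℝ 1 G) :
    ∫ ω, G (fun n => ((ω : Λ → sphere (0 : E) 1) n : E)) *
        -∑ k, siteLaplacian k F (fun n => (ω n : E))
          ∂Measure.pi (fun _ : Λ => uniformSphere (volume : Measure E)) =
      ∑ k, ∫ ω, ⟪siteGrad k G (fun n => ((ω : Λ → sphere (0 : E) 1) n : E)),
        siteGrad k F (fun n => (ω n : E))⟫
          ∂Measure.pi (fun _ : Λ => uniformSphere (volume : Measure E)) := by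
  simp_rw [mul_neg, integral_neg, integral_pi_uniformSphere_eq_mul, ← Finset.mul_sum,
    integral_mul_sum_siteLaplacian hF hG, mul_neg, neg_neg]

omit [DecidableEq Λ] in
/-- The rescaling constant times the total mass of `⊗_Λ σ` is `1` (both sides of `∫ 1 dπ̄ = 1`). -/
theorem integral_one_uniform_mul :
    (((((volume : Measure E).toSphere univ)⁻¹) ^ Fintype.card Λ).toReal) *
        (Measure.pi fun _ : Λ => (volume : Measure E).toSphere).real univ = 1 := by
  have h := integral_pi_uniformSphere_eq_mul (Λ := Λ) (E := E) (fun _ => (1 : ℝ))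
  rw [integral_const, integral_const, smul_eq_mul, smul_eq_mul, mul_one, mul_one, Measure.real,
    measure_univ, ENNReal.toReal_one] at h
  exact h.symm

variable {U : Λ → Λ → (E →L[ℝ] E)}

/-- **`∫ S dπ̄ = S₀`**: under the uniform product probability measure the Engel–Schaefer action has
mean `S₀` (the coupling term `−κΣ⟪x_n, J_n⟫` has mean zero; GEN-8's `integral_esAction`, rescaled). -/
theorem integral_esAction_uniform (hU0 : ∀ n, U n n = 0)
    (hUadj : ∀ m n (v w : E), ⟪U m n v, w⟫ = ⟪v, U n m w⟫) (h2 : 2 ≤ Module.finrank ℝ E)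
    (κ S₀ : ℝ) :
    ∫ ω, esAction κ S₀ U (fun n => ((ω : Λ → sphere (0 : E) 1) n : E))
      ∂Measure.pi (fun _ : Λ => uniformSphere (volume : Measure E)) = S₀ := by
  rw [integral_pi_uniformSphere_eq_mul, integral_esAction hU0 hUadj h2 κ S₀, ← measureReal_def,
    mul_left_comm, integral_one_uniform_mul, mul_one]

omit [DecidableEq Λ] in
/-- **Cauchy–Schwarz on `Ω`**: `(∫ f g dπ̄)² ≤ ∫ f² dπ̄ · ∫ g² dπ̄` for continuous `f`, `g`
(the discriminant of `t ↦ ∫(f − t g)² ≥ 0`). -/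
theorem sq_integral_mul_le {f g : (Λ → sphere (0 : E) 1) → ℝ} (hf : Continuous f)
    (hg : Continuous g) :
    (∫ ω, f ω * g ω ∂Measure.pi (fun _ : Λ => uniformSphere (volume : Measure E))) ^ 2 ≤
      (∫ ω, f ω ^ 2 ∂Measure.pi (fun _ : Λ => uniformSphere (volume : Measure E))) *
        ∫ ω, g ω ^ 2 ∂Measure.pi (fun _ : Λ => uniformSphere (volume : Measure E)) := by
  set μ : Measure (sphere (0 : E) 1) := uniformSphere (volume : Measure E) with hμ
  have hif : Integrable (fun ω => f ω ^ 2) (Measure.pi fun _ : Λ => μ) :=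
    integrable_pi_of_continuous μ (hf.pow 2)
  have hig : Integrable (fun ω => g ω ^ 2) (Measure.pi fun _ : Λ => μ) :=
    integrable_pi_of_continuous μ (hg.pow 2)
  have hifg : Integrable (fun ω => f ω * g ω) (Measure.pi fun _ : Λ => μ) :=
    integrable_pi_of_continuous μ (hf.mul hg)
  have key : ∀ t : ℝ, 0 ≤ (∫ ω, g ω ^ 2 ∂Measure.pi (fun _ : Λ => μ)) * (t * t) +
      (-2 * ∫ ω, f ω * g ω ∂Measure.pi (fun _ : Λ => μ)) * t +
        ∫ ω, f ω ^ 2 ∂Measure.pi (fun _ : Λ => μ) := fun t => by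
    have hi1 : Integrable (fun ω => t * t * g ω ^ 2 - 2 * t * (f ω * g ω))
      (Measure.pi fun _ : Λ => μ) :=
      (hig.const_mul _).sub (hifg.const_mul _)
    have e : (∫ ω, g ω ^ 2 ∂Measure.pi (fun _ : Λ => μ)) * (t * t) +
        (-2 * ∫ ω, f ω * g ω ∂Measure.pi (fun _ : Λ => μ)) * t +
          ∫ ω, f ω ^ 2 ∂Measure.pi (fun _ : Λ => μ) =
        ∫ ω, (f ω - t * g ω) ^ 2 ∂Measure.pi (fun _ : Λ => μ) := by
      have hfun : (fun ω => (f ω - t * g ω) ^ 2) =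
          fun ω => t * t * g ω ^ 2 - 2 * t * (f ω * g ω) + f ω ^ 2 := by
        funext ω; ring
      rw [hfun, integral_add hi1 hif, integral_sub (hig.const_mul _) (hifg.const_mul _),
        integral_const_mul, integral_const_mul]
      ring
    rw [e]
    exact integral_nonneg fun ω => sq_nonneg _
  have hd := discrim_le_zero key
  rw [discrim] at hd
  nlinarith [hd]

end Tools

/-! ## §2 The solvability condition in closed form; `ċ₁ = Var_π̄(S)` -/

section Constants

variable [Fintype Λ] [DecidableEq Λ] [Nonempty Λ] [Nontrivial E] {U : Λ → Λ → (E →L[ℝ] E)}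

omit [Nonempty Λ] in
/-- **THE CONSTANTS OF LÜSCHER'S RECURSION ARE COVARIANCES WITH THE ACTION.**  For every `C²`
Lüscher series `(St, c)` of `S = esAction κ S₀ U` (no self-coupling, adjoint pairs) and every `k`:
`c_{k+1} = 2(d−1) · ∫ St_k · (S − S₀) dπ̄` — integrate the order-`(k+1)` equation against `π̄`
(`∫Σ∂̃² = 0`), use the polarised Green identity and E–S's `−Σ∂̃²S = 2(d−1)(S − S₀)`. -/
theorem luscher_constant_succ_eq (hU0 : ∀ n, U n n = 0)
    (hUadj : ∀ m n (v w : E), ⟪U m n v, w⟫ = ⟪v, U n m w⟫) (κ S₀ : ℝ)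
    {St : ℕ → (Λ → E) → ℝ} {c : ℕ → ℝ} (hSt : ∀ k, ContDiff ℝ 2 (St k))
    (hs : ∀ k, ∀ ξ : Λ → sphere (0 : E) 1,
      -∑ n, siteLaplacian n (St (k + 1)) (fun m => (ξ m : E)) =
        -(∑ n, ⟪siteGrad n (esAction κ S₀ U) (fun m => (ξ m : E)),
            siteGrad n (St k) (fun m => (ξ m : E))⟫) + c (k + 1)) (k : ℕ) :
    c (k + 1) = 2 * ((Module.finrank ℝ E : ℝ) - 1) *
      ∫ ω, St k (fun m => ((ω : Λ → sphere (0 : E) 1) m : E)) *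
        (esAction κ S₀ U (fun m => (ω m : E)) - S₀)
          ∂Measure.pi (fun _ : Λ => uniformSphere (volume : Measure E)) := by
  have hS2 : ContDiff ℝ 2 (esAction κ S₀ U) := contDiff_esAction U κ S₀
  have hSt1 : ContDiff ℝ 1 (St k) := (hSt k).of_le (by norm_num)
  -- (1) integrate the order-(k+1) equation: `c_{k+1} = ∫ Σ⟪∂̃S, ∂̃St_k⟫ dπ̄`
  have h0 := integral_luscher_uniform_eq_zero (Λ := Λ) (hSt (k + 1))
  have hcont : Continuous fun ω : Λ → sphere (0 : E) 1 =>
      ∑ n, ⟪siteGrad n (esAction κ S₀ U) (fun m => (ω m : E)),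
        siteGrad n (St k) (fun m => (ω m : E))⟫ :=
    continuous_finsetSum Finset.univ fun n _ =>
      continuous_inner_siteGrad hSt1 (hS2.of_le (by norm_num)) n n
  have hint : Integrable (fun ω : Λ → sphere (0 : E) 1 =>
      ∑ n, ⟪siteGrad n (esAction κ S₀ U) (fun m => (ω m : E)),
        siteGrad n (St k) (fun m => (ω m : E))⟫)
          (Measure.pi fun _ : Λ => uniformSphere (volume : Measure E)) :=
    integrable_pi_of_continuous _ hcont
  have hsum : ∀ ω : Λ → sphere (0 : E) 1,
      ∑ n, siteLaplacian n (St (k + 1)) (fun m => (ω m : E)) =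
        (∑ n, ⟪siteGrad n (esAction κ S₀ U) (fun m => (ω m : E)),
          siteGrad n (St k) (fun m => (ω m : E))⟫) - c (k + 1) := fun ω => by
    have h := hs k ω
    linarith
  simp_rw [hsum] at h0
  rw [integral_sub hint (integrable_const _), integral_const, smul_eq_mul, Measure.real,
    measure_univ, ENNReal.toReal_one, one_mul, sub_eq_zero] at h0
  -- (2) polarised Green + the eigenfunction property of `S`
  have hgreen := integral_mul_neg_luscher_uniform (Λ := Λ) hS2 hSt1
  have heig : ∀ ω : Λ → sphere (0 : E) 1,
      -∑ n, siteLaplacian n (esAction κ S₀ U) (fun m => (ω m : E)) =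
        2 * ((Module.finrank ℝ E : ℝ) - 1) * (esAction κ S₀ U (fun m => (ω m : E)) - S₀) :=
    fun ω => neg_sum_siteLaplacian_esAction hU0 hUadj κ S₀ fun n => by simp
  simp_rw [heig] at hgreen
  rw [← h0, integral_finsetSum Finset.univ fun n _ => integrable_pi_of_continuous
    (uniformSphere (volume : Measure E))
    (continuous_inner_siteGrad hSt1 (hS2.of_le (by norm_num)) n n)]
  simp_rw [real_inner_comm (siteGrad _ (St k) _)]
  rw [← hgreen, ← integral_const_mul]
  exact integral_congr_ae (ae_of_all _ fun ω => by ring)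

omit [Nonempty Λ] in
/-- **`ċ₁ = Var_π̄(S)`: THE ORDER-ONE CONSTANT OF LÜSCHER'S RECURSION IS THE VARIANCE OF THE ACTION
UNDER THE UNIFORM MEASURE.**  For every `C²` Lüscher series of the E–S action,
`c₁ = ∫ (S − S₀)² dπ̄` (and `∫S dπ̄ = S₀`, so this is `Var_π̄(S)`): order `0` is `S/(2(d−1))` up to a
constant on `Ω` (GEN-8 `loFlowAction_unique`), and the constant drops out because `S − S₀` has mean
zero. -/
theorem luscher_constant_one_eq (h2 : 2 ≤ Module.finrank ℝ E) (hU0 : ∀ n, U n n = 0)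
    (hUadj : ∀ m n (v w : E), ⟪U m n v, w⟫ = ⟪v, U n m w⟫) (κ S₀ : ℝ)
    {St : ℕ → (Λ → E) → ℝ} {c : ℕ → ℝ} (hSt : ∀ k, ContDiff ℝ 2 (St k))
    (h0 : ∀ ξ : Λ → sphere (0 : E) 1,
      -∑ n, siteLaplacian n (St 0) (fun m => (ξ m : E)) =
        esAction κ S₀ U (fun m => (ξ m : E)) + c 0)
    (hs : ∀ k, ∀ ξ : Λ → sphere (0 : E) 1,
      -∑ n, siteLaplacian n (St (k + 1)) (fun m => (ξ m : E)) =
        -(∑ n, ⟪siteGrad n (esAction κ S₀ U) (fun m => (ξ m : E)),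
            siteGrad n (St k) (fun m => (ξ m : E))⟫) + c (k + 1)) :
    c 1 = ∫ ω, (esAction κ S₀ U (fun m => ((ω : Λ → sphere (0 : E) 1) m : E)) - S₀) ^ 2
      ∂Measure.pi (fun _ : Λ => uniformSphere (volume : Measure E)) := by
  set μ : Measure (sphere (0 : E) 1) := uniformSphere (volume : Measure E) with hμ
  haveI : Nonempty (sphere (0 : E) 1) := (NormedSpace.sphere_nonempty.mpr zero_le_one).to_subtype
  obtain ⟨-, hconst⟩ := loFlowAction_unique hU0 hUadj h2 κ S₀ (hSt 0) h0
  set ξ₀ : Λ → sphere (0 : E) 1 := Classical.arbitrary _ with hξ₀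
  set e : ℝ := St 0 (fun m => (ξ₀ m : E)) - loFlowAction κ S₀ U (fun m => (ξ₀ m : E)) with he
  have hd : (2 : ℝ) * ((Module.finrank ℝ E : ℝ) - 1) ≠ 0 := by
    have : (2 : ℝ) ≤ Module.finrank ℝ E := by exact_mod_cast h2
    intro h; nlinarith
  -- order 0 on Ω: `St 0 = S/(2(d−1)) + e`
  have hSt0 : ∀ ω : Λ → sphere (0 : E) 1, St 0 (fun m => (ω m : E)) =
      (2 * ((Module.finrank ℝ E : ℝ) - 1))⁻¹ * esAction κ S₀ U (fun m => (ω m : E)) + e :=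
      fun ω => by
    have h := hconst ω ξ₀
    rw [← he] at h
    unfold loFlowAction at h
    linarith
  rw [luscher_constant_succ_eq hU0 hUadj κ S₀ hSt hs 0]
  simp_rw [hSt0]
  have hSc : Continuous fun ω : Λ → sphere (0 : E) 1 => esAction κ S₀ U (fun m => (ω m : E)) :=
    (contDiff_esAction U κ S₀ (m := 0)).continuous.comp continuous_sphereConfig
  have hmean : ∫ ω, (esAction κ S₀ U (fun m => ((ω : Λ → sphere (0 : E) 1) m : E)) - S₀)
      ∂Measure.pi (fun _ : Λ => μ) = 0 := by
    rw [integral_sub (integrable_pi_of_continuous μ hSc) (integrable_const _),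
      integral_esAction_uniform hU0 hUadj h2 κ S₀, integral_const, smul_eq_mul, Measure.real,
      measure_univ, ENNReal.toReal_one, one_mul, sub_self]
  have hi1 : Integrable (fun ω : Λ → sphere (0 : E) 1 =>
      (esAction κ S₀ U (fun m => (ω m : E)) - S₀) ^ 2) (Measure.pi fun _ : Λ => μ) :=
    integrable_pi_of_continuous μ ((hSc.sub continuous_const).pow 2)
  have hi2 : Integrable (fun ω : Λ → sphere (0 : E) 1 =>
      (esAction κ S₀ U (fun m => (ω m : E)) - S₀)) (Measure.pi fun _ : Λ => μ) :=
    integrable_pi_of_continuous μ (hSc.sub continuous_const)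
  have hfun : (fun ω : Λ → sphere (0 : E) 1 =>
      ((2 * ((Module.finrank ℝ E : ℝ) - 1))⁻¹ * esAction κ S₀ U (fun m => (ω m : E)) + e) *
        (esAction κ S₀ U (fun m => (ω m : E)) - S₀)) =
      fun ω => (2 * ((Module.finrank ℝ E : ℝ) - 1))⁻¹ *
        (esAction κ S₀ U (fun m => (ω m : E)) - S₀) ^ 2 +
          ((2 * ((Module.finrank ℝ E : ℝ) - 1))⁻¹ * S₀ + e) *
            (esAction κ S₀ U (fun m => (ω m : E)) - S₀) := by
    funext ω; ring
  rw [hfun, integral_add (hi1.const_mul _) (hi2.const_mul _), integral_const_mul,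
    integral_const_mul, hmean, mul_zero, add_zero, ← mul_assoc, mul_inv_cancel₀ hd, one_mul]

end Constants

end Summit.Ventures.LatticeQCDFlow.Exactness

end
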